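import Summits.ABC.ABC.Theses.CubicResolventAllowance
import Literature.NumberTheory.DiophantineGeometry.SubexponentialSzpiroFamilies
import Literature.NumberTheory.EllipticCurves.Szpiro
import HarnessLib

/-!
# STUB-IDEAS `stub_realCubic` · ideator k1 (FAMILY 1 — recognise & import) · generation 10

Crux stmt-ABC-22740 `CubicResolventAllowance.IndexSzpiro`, stub `stub_realCubic` (the `0 < d_K` half).
Companion of `STUB-IDEAS-stub_realCubic-1.md` rev 10.  Bank of gens 2–9 unchanged and BY REFERENCE
(`StubIdeas1RealSketchG8.lean`: N5 `signDoorPos_holds`, H2 `dvd_mul_den_j`, H3 `conductorNorm_jPencil_dvd`,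
H4 `abcOffCubes_sixteen_of_stubReal`; R0a/R0b/H4c/R10′ kernel-checked there).

NEW in gen 10 (literature match, window 2024–2026): the THINNEST FIBRE of the stub is a one-variable
statement about a FIXED cubic polynomial.  On the unit line `U_m : y² = x³ − 3·m·x + 2` (`m ≥ 2`;
`Δ = 1728·(m³ − 1) > 0`, `ψ₂ = 4(X³ − 3mX + 2)` irreducible, so `U_m` is in the stub's class) the stub says
`rad(m³ − 1) ≥ c_ε · m^{3/(8+ε)}` — a POWER-SAVING lower bound for the radical of the values of
`f(m) = m³ − 1 = (1·m + 0)³ + (−1)`, exactly the shape treated by Cuevas Barrientos–Pasten 2025, Thm 1.3,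
whose bound `rad(f(m)) ≥ exp(κ_f (log₂ m)²/log₃ m)` (arXiv:2504.15971 p.3) is the state of the art and is
sub-polynomial; `abc` predicts `m^{2−ε}` (Langevin).  So any proof of `stub_realCubic` proves a power saving
for `rad(m³ − 1)` — beyond every method in print (modular + linear forms).  `sorry` = proposal (sizes in
docstrings); identities are kernel-checked.  Nothing here proves the stub (verdict open-problem stands).
-/

set_option linter.dupNamespace false

noncomputable section

namespace Summit.ABC.ABC.Cruxes.IndexSzpiro.StubIdeasRealCubic1G10

open Polynomial UniqueFactorizationMonoid WeierstrassCurve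
open Literature.NumberTheory.EllipticCurves Literature.NumberTheory.DiophantineGeometry

/-- The stub, verbatim (payload `stub.signature`). -/
def StubReal : Prop :=
  ∀ ε : ℝ, 0 < ε → ∃ C : ℝ, ∀ (W : WeierstrassCurve ℚ) [W.IsElliptic] (K : Type) [Field K] [NumberField K],
    Irreducible W.twoTorsionPolynomial.toPoly → Module.finrank ℚ K = 3 →
    (∃ θ : K, aeval θ W.twoTorsionPolynomial.toPoly = 0) → 0 < NumberField.discr K →
    (W.minimalDiscriminantNorm ℤ : ℝ) ≤ C * |(NumberField.discr K : ℝ)| * (W.conductorNorm ℤ : ℝ) ^ (6 + ε)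

/-- R0a (kernel-checked, = G7/G8). The route crux gives the stub. [folklore] -/
theorem stubReal_of_indexSzpiro (h : Summit.ABC.ABC.Theses.CubicResolventAllowance.IndexSzpiro) :
    StubReal := by
  intro ε hε
  obtain ⟨C, hC⟩ := h ε hε
  exact ⟨C, fun W _ K _ _ hirr h3 hθ _ => hC W K hirr h3 hθ⟩

/-! ## The unit line `U_m : y² = x³ − 3mx + 2` of the `(2,3,∞)` corner (k3 `E_{y,z}` at `y = −1`, `z = m`) -/

/-- `U_m : y² = x³ − 3·m·x + 2` over `ℚ` (`c₄ = 144m`, `c₆ = −1728`, `Δ = 1728(m³ − 1)`). -/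
def unitLine (m : ℕ) : WeierstrassCurve ℚ := ⟨0, 0, 0, -3 * (m : ℚ), 2⟩

/-- `Δ(U_m) = 1728·(m³ − 1)` (kernel-checked). [folklore] -/
theorem unitLine_Δ (m : ℕ) : (unitLine m).Δ = 1728 * ((m : ℚ) ^ 3 - 1) := by
  simp only [unitLine, WeierstrassCurve.Δ, WeierstrassCurve.b₂, WeierstrassCurve.b₄, WeierstrassCurve.b₆,
    WeierstrassCurve.b₈]
  ring

/-- `c₄(U_m) = 144·m` (kernel-checked). [folklore] -/
theorem unitLine_c₄ (m : ℕ) : (unitLine m).c₄ = 144 * (m : ℚ) := by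
  simp only [unitLine, WeierstrassCurve.c₄, WeierstrassCurve.b₂, WeierstrassCurve.b₄]
  ring

/-- `c₆(U_m) = −1728` (kernel-checked; so a rescaling `u` of an integral model has `u⁶ ∣ 2⁶3³`, `u ∣ 2`). [folklore] -/
theorem unitLine_c₆ (m : ℕ) : (unitLine m).c₆ = -1728 := by
  simp only [unitLine, WeierstrassCurve.c₆, WeierstrassCurve.b₂, WeierstrassCurve.b₄, WeierstrassCurve.b₆]
  ring

/-- The 2-division polynomial of `U_m` is `4X³ − 12mX + 8 = 4(X³ − 3mX + 2)` (kernel-checked). [folklore] -/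
theorem unitLine_twoTorsionPolynomial (m : ℕ) :
    (unitLine m).twoTorsionPolynomial = ⟨4, 0, -12 * (m : ℚ), 8⟩ := by
  simp only [unitLine, WeierstrassCurve.twoTorsionPolynomial, WeierstrassCurve.b₂, WeierstrassCurve.b₄,
    WeierstrassCurve.b₆]
  congr 1 <;> ring

/-- `U_m` is the fibre at `m` of the Cuevas Barrientos–Pasten surface with `A(t) = −3t`, `B(t) = 2`
(kernel-checked), so their Thm 1.1 (`CuevasPasten2025_thm_1_1`, typed in the tree) applies to the line. [folklore] -/
theorem unitLine_eq_cuevasPastenFibre (m : ℕ) :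
    unitLine m = cuevasPastenFibre (-3 * X) (C 2) (m : ℤ) := by
  simp [unitLine, cuevasPastenFibre]

/-- `Δ(U_m) > 0` for `m ≥ 2` (kernel-checked): the line lies in the REAL half (`0 < d_K` by the sign door N5). [folklore] -/
theorem unitLine_Δ_pos {m : ℕ} (hm : 2 ≤ m) : 0 < (unitLine m).Δ := by
  rw [unitLine_Δ]
  have h2 : (2 : ℚ) ≤ (m : ℚ) := by exact_mod_cast hm
  have h1 : (1 : ℚ) < (m : ℚ) ^ 3 := one_lt_pow₀ (by linarith) (by norm_num)
  exact mul_pos (by norm_num) (sub_pos.2 h1)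

/-! ## Proposed helpers (gen 10; `sorry` = proposal) -/

/-- **H6a (S/M).** `ψ₂(U_m) = 4(X³ − 3mX + 2)` is irreducible over `ℚ` for every `m ≠ 1` (rational root test:
a root is `±1, ±2`; `X = 1, −2` force `m = 1`, `X = −1, 2` are impossible). Tools: `unitLine_twoTorsionPolynomial`,
`Cubic.toPoly`, degree-3 irreducibility iff no rational root (Gauss + `Polynomial.Monic.irreducible_iff_roots_eq_zero_of_degree_le_three`
on the monic associate), denominators via `Rat` num/den. [folklore] -/
theorem unitLine_twoTorsion_irreducible {m : ℕ} (hm : m ≠ 1) :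
    Irreducible (unitLine m).twoTorsionPolynomial.toPoly := by
  sorry

/-- **H6b (M).** Conductor of the unit line: `N(U_m) ∣ 2⁸·3⁵·rad(m³ − 1)` for `m ≥ 2` — at `p ≥ 5`, `p ∣ m³ − 1 ⟹ p ∤ m ⟹
p ∤ c₄ = 144m ⟹` multiplicative (`f_p = 1`), `p ∤ 6(m³−1) ⟹ f_p = 0`; caps `f₂ ≤ 8`, `f₃ ≤ 5`.  TEMPLATE = the landed
`conductorNorm_hallModel_dvd` / `IsABCTriple.conductorNorm_freyCurve_dvd` (tree: `conductorNorm_dvd_of_forall_conductorExponent_le`,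
`conductorExponent_le_eight_holds`, `conductorExponent_le_five_of_natGenerator_eq_three_holds`,
`conductorExponent_eq_one_of_dvd_Δ_of_not_dvd_c₄`, `conductorExponent_eq_zero_of_not_dvd_Δ`); = k3 H3 at `(y,z) = (−1,m)`. [folklore] -/
theorem unitLine_conductorNorm_dvd {m : ℕ} (hm : 2 ≤ m) [(unitLine m).IsElliptic] :
    (unitLine m).conductorNorm ℤ ∣ 2 ^ 8 * 3 ^ 5 * radical (M := ℕ) (m ^ 3 - 1) := by
  sorry

/-- **H6c (M−).** Minimal discriminant of the unit line from below: `27·(m³ − 1) ≤ 64·Δ_min(U_m)` (a rescaling `u` of an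
integral model has `u⁶ ∣ c₆ = 2⁶3³`, so `u ∣ 2` and `Δ_min ≥ Δ/2¹²`; tree: `minimalDiscriminantNorm_int_eq_natAbs_minimalDiscriminantInt_holds`,
`TwoTorsionDictionary`-style bookkeeping); = k3 H3b at `(y,z) = (−1,m)`. [folklore] -/
theorem unitLine_minimalDisc_ge {m : ℕ} (hm : 2 ≤ m) [(unitLine m).IsElliptic] :
    27 * (m ^ 3 - 1) ≤ 64 * (unitLine m).minimalDiscriminantNorm ℤ := by
  sorry

/-- TARGET CURRENCY (print): a power-saving lower bound for the radical of the values of `m³ − 1`.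
OPEN for every `θ > 0`; best in print is sub-polynomial (Cuevas Barrientos–Pasten 2025 Thm 1.3 for `(am+b)³ + c`;
Pasten 2024 Thm 1.2 for `n² + 1`); `abc` gives every `θ < 2` (Langevin / Bombieri–Gubler 12.2.12). -/
def RadPowerSavingCubeMinusOne (θ : ℝ) : Prop :=
  ∃ c : ℝ, 0 < c ∧ ∀ m : ℕ, 2 ≤ m → c * (m : ℝ) ^ θ ≤ (radical (M := ℕ) (m ^ 3 - 1) : ℝ)

/-- **H6 (M; the gen-10 certificate).** `stub_realCubic ⟹ rad(m³ − 1) ≥ c_ε·m^{3/(8+ε)}`.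
Proof plan: for `m ≥ 2` take `W = U_m` (elliptic: `Δ ≠ 0`), `K = AdjoinRoot` of the monic associate of `ψ₂` (k3 H6
`cubicFieldOfIrreducible`, PROVED in `StubIdeas3SketchG7.lean`; `finrank = 3`, a root), H6a (irreducible), N5 + `unitLine_Δ_pos`
(`0 < d_K`); the stub gives `Δ_min ≤ C·d_K·N^{6+ε}`, the LANDED support `resolventDiscBounds_proof` gives `d_K ≤ 1944·N²`,
H6b gives `N ≤ 2⁸3⁵·rad(m³−1)`, H6c gives `Δ_min ≥ 27(m³−1)/64 ≥ 27m³/128`; solve for `rad`.  Real bookkeeping =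
playbook "pointwise real inequality, `calc` + `gcongr` + `Real.rpow_le_rpow`". [folklore] -/
theorem radPowerSaving_of_stubReal (h : StubReal) {ε : ℝ} (hε : 0 < ε) :
    RadPowerSavingCubeMinusOne (3 / (8 + ε)) := by
  sorry

/-- **H6′ (S ∘ H6).** The hypothesis-free calibration of the ROUTE CRUX on its thinnest fibre. [folklore] -/
theorem radPowerSaving_of_indexSzpiro (h : Summit.ABC.ABC.Theses.CubicResolventAllowance.IndexSzpiro)
    {ε : ℝ} (hε : 0 < ε) : RadPowerSavingCubeMinusOne (3 / (8 + ε)) :=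
  radPowerSaving_of_stubReal (stubReal_of_indexSzpiro h) hε

/-- **H7 (S ∘ H6; kernel-checked modulo H6).** MERSENNE CURRENCY — the real half pays in the tree's open currency
`radical (mersenne n)` (cf. `Summit.ABC.ABC.Theorems.SingleTowerSzpiroLine.radical_mersenne_ge_of_polySzpiroRat`,
`…_of_subexponentialSzpiro`; complex sibling k1-G3 `A6_radical_mersenne_ge_of_stub` on `ℚ(∛2)`, residues `n ≡ 5 (mod 6)`):
at `m = 2^k` the unit line `U_{2^k}` (2-division field VARYING with `k`, totally real) gives
`stub_realCubic ⟹ rad(2^{3k} − 1) ≥ c_ε · 2^{3k/(8+ε)}` — EXPONENTIAL in `n = 3k` (A-PS scale `2^{2n/K}`, `K = 16 + 2ε`);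
in print: `rad(2ⁿ−1) ≫ n³/(log n)⁹` (Stewart–Yu, `Literature.Barriers.ABC.BakerMethodBounds`), `abc ⟹ 2^{(1−ε)n}`. [folklore] -/
theorem radical_mersenne_ge_of_stubReal (h : StubReal) {ε : ℝ} (hε : 0 < ε) :
    ∃ c : ℝ, 0 < c ∧ ∀ k : ℕ, 1 ≤ k →
      c * (2 : ℝ) ^ ((3 * k : ℝ) / (8 + ε)) ≤ ((radical (mersenne (3 * k)) : ℕ) : ℝ) := by
  obtain ⟨c, hc, H⟩ := radPowerSaving_of_stubReal h hε
  refine ⟨c, hc, fun k hk => ?_⟩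
  have hm : 2 ≤ 2 ^ k := by
    calc 2 = 2 ^ 1 := by norm_num
      _ ≤ 2 ^ k := Nat.pow_le_pow_right (by norm_num) hk
  have h1 := H (2 ^ k) hm
  have hmer : (2 ^ k) ^ 3 - 1 = mersenne (3 * k) := by
    rw [mersenne, ← pow_mul, mul_comm]
  rw [hmer] at h1
  have hcast : ((2 ^ k : ℕ) : ℝ) ^ ((3 : ℝ) / (8 + ε)) = (2 : ℝ) ^ ((3 * k : ℝ) / (8 + ε)) := by
    push_cast
    rw [← Real.rpow_natCast, ← Real.rpow_mul (by norm_num)]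
    congr 1
    ring
  rw [hcast] at h1
  exact h1

/-- **H7′ (∘ R0a).** The ROUTE CRUX in the Mersenne currency, hypothesis-free modulo H6. [folklore] -/
theorem radical_mersenne_ge_of_indexSzpiro (h : Summit.ABC.ABC.Theses.CubicResolventAllowance.IndexSzpiro)
    {ε : ℝ} (hε : 0 < ε) :
    ∃ c : ℝ, 0 < c ∧ ∀ k : ℕ, 1 ≤ k →
      c * (2 : ℝ) ^ ((3 * k : ℝ) / (8 + ε)) ≤ ((radical (mersenne (3 * k)) : ℕ) : ℝ) :=
  radical_mersenne_ge_of_stubReal (stubReal_of_indexSzpiro h) hε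

/-! ## The ceiling in print on the same fibre (placement only; candidate named facts, NOT to be proved here) -/

/-- CEILING 1 (candidate named fact, Cuevas Barrientos–Pasten 2025 **Thm 1.3** at `f(m) = m³ − 1 = (1·m+0)³ + (−1)`):
`rad(m³ − 1) ≥ exp(κ·(log⁎₂ m)²/log⁎₃ m)` — sub-polynomial.  Stated in the tree's `max 1 ∘ log` convention.
[cite: CuevasPasten2025SubexpSzpiro, Thm. 1.3 (§1.1, p.3)] -/
def CeilingRadCubeMinusOne : Prop :=
  ∃ κ : ℝ, 0 < κ ∧ ∃ m₀ : ℕ, ∀ m : ℕ, m₀ ≤ m →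
    Real.exp (κ * (max 1 (Real.log (Real.log m))) ^ 2 / max 1 (Real.log (Real.log (Real.log m)))) ≤
      (radical (M := ℕ) (m ^ 3 - 1) : ℝ)

/-- CEILING 2 (conditional on the typed named fact `CuevasPasten2025_thm_1_1`; S/M to prove): ε-SHAPE Szpiro on the unit
line, `log Δ_min(U_m) ≤ C_ε·N(U_m)^ε` — via `unitLine_eq_cuevasPastenFibre`, `CuevasPasten2025_thm_1_1.cor_1_2`
(`A = −3t`, `B = 2`: coprime over `ℚ`, `A` non-constant, `4A³ + 27B² = 108(1 − t³) ≠ 0`) and Silverman's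
`log_minimalDiscriminantNorm_lt_faltingsHeight_holds` (+ the `𝓞 ℚ`/`ℤ` bridge `minimalDiscriminantNorm_int_eq_…`).
The stub demands the POLYNOMIAL shape `Δ_min ≤ C·N^{8+ε}` on this line; the gap is the A-PS gap itself. [folklore] -/
theorem epsShape_unitLine_of_CP (h : CuevasPasten2025_thm_1_1) :
    ∀ ε : ℝ, 0 < ε → ∃ C : ℝ, ∀ (m : ℕ) [(unitLine m).IsElliptic],
      Real.log ((unitLine m).minimalDiscriminantNorm ℤ : ℝ) ≤ C * ((unitLine m).conductorNorm ℤ : ℝ) ^ ε := by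
  sorry

end Summit.ABC.ABC.Cruxes.IndexSzpiro.StubIdeasRealCubic1G10

end
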